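import Literature.MathematicalPhysics.QuantumLattice.HubbardLinkedCluster
import Mathlib.Analysis.Normed.Group.Tannery
import Mathlib.Analysis.SpecificLimits.Normed
import HarnessLib

/-!
# Reduction of `bgm_two_point_limit` to volume-uniform linked-cluster estimates

Topic `MathematicalPhysics/QuantumLattice`; programme under the tree's fact `bgm_two_point_limit`
(`HubbardFermiLiquid.lean`; Benfatto–Giuliani–Mastropietro, Ann. Henri Poincaré 7 (2006) 809,
Thm. 1.1). `HubbardLinkedCluster.lean` proves the finite-volume linked-cluster theorem
`⟨c†_{xσ}c_{yσ'}⟩_{β,L} = Σ_j U^j t_j(L)` (absolutely convergent truncated series). This file adds the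
limit step (Tannery's theorem = dominated convergence for series): if the truncated coefficients
`t_j(L)` (`hubbardTorusTruncatedCoeff`) obey, for all large `L`, a geometric bound `‖t_j(L)‖ ≤ C/rʲ`
with `|U| < r`, and converge termwise as `L → ∞`, then the torus two-point functions converge
(`tendsto_hubbardThermalTwoPoint_of_truncated_bounds`); hence the fact `bgm_two_point_limit`
follows from such estimates in BGM's regime (`bgm_two_point_limit_of_truncated_bounds`, a proved
reduction with the analytic input as an explicit hypothesis). The input — a radius `r(β, μ)`
uniform in the volume with `r ≥ U₀` for `β ≤ e^{c/U₀}`, and the termwise limits — is exactly what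
BGM's Gram–Hadamard/tree bounds (2.66), (2.77), the multiscale resummation of §2.2–§3 and the
finite-`L` discussion ([BM2001], §2.3 footnote 1) provide; none of it is asserted here.
Everything is PROVED; the only definition is the notation `hubbardTorusTruncatedCoeff`.

## Where the programme under `bgm_two_point_limit` stands (operator side, this line of files)

PROVED in the tree: finite-volume Gibbs/KMS structure and bounds of BGM §1.2
(`HubbardSchwingerFunction`, `GibbsTwoTimeBound`, `HubbardSchwingerFunctionBound`,
`HubbardSchwingerEquicontinuity`); the perturbation series (2.6)/(2.8) in determinant form
(`DysonExpansion`, `DysonOrderedIntegral`, `FermionQuasiFreeTimeOrderedWick`,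
`HubbardDysonDeterminant`); the linked-cluster theorem (`HubbardLinkedCluster`) and the present
reduction; the high-temperature corner `β ≤ β_HT` of the fact for all `U`
(`HubbardHighTemperatureTwoPoint.bgm_two_point_limit_of_le_betaHT`). NOT in the tree (the
hypotheses of `bgm_two_point_limit_of_truncated_bounds`): (A) bounds `‖t_j(L)‖ ≤ C/rʲ` uniform in
`L` — already the single-scale radius `r(β) ~ β^{-α}` needs a Gram representation of the
time-ordered propagator matrix `propMatrix` with `L`-uniform constants (the Matsubara ultraviolet
problem; Pedra–Salmhofer 2008, BGM App. A1) to feed `FermionicTreeExpansionDecay.sum_norm_ursellOf_moment_le`,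
and BGM's radius `r ≥ U₀` for `β ≤ e^{c/U₀}` is their multiscale analysis (Thm. 2.1, §3);
(B) the termwise limits `t_j(L) → τ_j` (decay of the finite-temperature torus propagator uniform
in `L`, the tree expansion at fixed order, Riemann-sum limits as in `HubbardFreePropagatorLimit`).

## References

* G. Benfatto, A. Giuliani, V. Mastropietro, Ann. Henri Poincaré 7 (2006) 809–898, Thm. 1.1, §2.2
  (2.13)–(2.16), Thm. 2.1 (2.77), §2.3 footnote 1. [BenfattoGiulianiMastropietro2006]
-/

noncomputable section

open scoped Matrix.Norms.L2Operator ComplexOrder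
open Finset MeasureTheory intervalIntegral Filter Topology NormedSpace

namespace Literature.MathematicalPhysics.QuantumLattice

section Limit

open Literature.Probability.LatticeModels

/-- **The linked-cluster coefficients of the torus two-point function of `bgm_two_point_limit`**:
`t_j(L) = hubbardTruncatedCoeff` of the 2D Hubbard torus of side `L` (hopping `1`) between the
projections of the sites `x, y ∈ ℤ²` (junk `0` for `L = 0`, as in `hubbardThermalTwoPoint`).
[cite: BenfattoGiulianiMastropietro2006, §2.2 (2.14)-(2.16)] -/
def hubbardTorusTruncatedCoeff (β μ : ℝ) (L : ℕ) (x y : Site 2) (σ σ' : Fin 2) (j : ℕ) : ℂ :=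
  if hL : L = 0 then 0
  else
    haveI : NeZero L := ⟨hL⟩
    hubbardTruncatedCoeff (fermionTorusGraph 2 L) β 1 μ (FermionTorus.ofTorusSite (Torus.proj L x))
      (FermionTorus.ofTorusSite (Torus.proj L y)) σ σ' j

/-- Unfolding `hubbardTorusTruncatedCoeff` for `L ≠ 0`. [folklore] -/
theorem hubbardTorusTruncatedCoeff_of_neZero (β μ : ℝ) (L : ℕ) [NeZero L] (x y : Site 2)
    (σ σ' : Fin 2) (j : ℕ) :
    hubbardTorusTruncatedCoeff β μ L x y σ σ' j =
      hubbardTruncatedCoeff (fermionTorusGraph 2 L) β 1 μ (FermionTorus.ofTorusSite (Torus.proj L x))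
        (FermionTorus.ofTorusSite (Torus.proj L y)) σ σ' j := by
  rw [hubbardTorusTruncatedCoeff, dif_neg (NeZero.ne L)]

/-- **Thermodynamic limit from volume-uniform linked-cluster bounds (Tannery).** If, for `L`
large, the truncated coefficients obey a geometric bound `‖t_j(L)‖ ≤ C/rʲ` with `|U| < r`, and each
`t_j(L)` converges as `L → ∞` (to `τ_j`), then the torus two-point function of `bgm_two_point_limit`
converges to `Σ_j U^j τ_j`: the linked-cluster series (`hubbardThermalTwoPoint_eq_tsum_truncated`)
plus dominated convergence for series. This isolates what BGM's analysis (Gram–Hadamard/tree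
bounds (2.66), (2.77) with the multiscale resummation of §2.2–§3, and the finite-`L` discussion of
[BM2001], footnote 1 of §2.3) supplies: the radius `r(β, μ)` uniform in `L` (the fact needs
`r ≥ U₀` whenever `β ≤ e^{c/U₀}`) and the termwise limits. [cite: BenfattoGiulianiMastropietro2006, Thm. 1.1 and §2.3 footnote 1] -/
theorem tendsto_hubbardThermalTwoPoint_of_truncated_bounds (β U μ : ℝ) (x y : Site 2)
    (σ σ' : Fin 2) {r C : ℝ} (hU : |U| < r)
    (hC : ∀ᶠ L : ℕ in atTop, ∀ j : ℕ, ‖hubbardTorusTruncatedCoeff β μ L x y σ σ' j‖ ≤ C / r ^ j)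
    {τ : ℕ → ℂ}
    (hlim : ∀ j : ℕ, Tendsto (fun L : ℕ => hubbardTorusTruncatedCoeff β μ L x y σ σ' j) atTop (𝓝 (τ j))) :
    Tendsto (fun L : ℕ => hubbardThermalTwoPoint β U μ L x y σ σ') atTop
      (𝓝 (∑' j : ℕ, (U : ℂ) ^ j * τ j)) := by
  have hr : 0 < r := (abs_nonneg U).trans_lt hU
  have hq : |U| / r < 1 := (div_lt_one hr).2 hU
  have hq0 : 0 ≤ |U| / r := div_nonneg (abs_nonneg U) hr.le
  -- the dominating geometric series
  have h_sum : Summable fun j : ℕ => C * (|U| / r) ^ j :=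
    (summable_geometric_of_lt_one hq0 hq).mul_left C
  -- the termwise bound `‖U^j t_j(L)‖ ≤ C (|U|/r)^j`
  have h_bound : ∀ᶠ L : ℕ in atTop, ∀ j : ℕ,
      ‖(U : ℂ) ^ j * hubbardTorusTruncatedCoeff β μ L x y σ σ' j‖ ≤ C * (|U| / r) ^ j := by
    filter_upwards [hC] with L hL j
    rw [norm_mul, norm_pow, Complex.norm_real, Real.norm_eq_abs, div_pow, mul_div_assoc', mul_comm C,
      mul_div_assoc]
    exact mul_le_mul_of_nonneg_left (hL j) (pow_nonneg (abs_nonneg U) j)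
  have htann := tendsto_tsum_of_dominated_convergence (𝓕 := atTop)
    (f := fun (L : ℕ) (j : ℕ) => (U : ℂ) ^ j * hubbardTorusTruncatedCoeff β μ L x y σ σ' j)
    (g := fun j => (U : ℂ) ^ j * τ j) h_sum (fun j => (hlim j).const_mul _) h_bound
  -- the two-point function equals its linked-cluster series for `L ≥ 1` under the bound
  refine htann.congr' ?_
  filter_upwards [h_bound, eventually_ge_atTop 1] with L hL hL1
  haveI : NeZero L := ⟨by omega⟩
  have hs : Summable fun j : ℕ => ‖(U : ℂ) ^ j *
      hubbardTruncatedCoeff (fermionTorusGraph 2 L) β 1 μ (FermionTorus.ofTorusSite (Torus.proj L x))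
        (FermionTorus.ofTorusSite (Torus.proj L y)) σ σ' j‖ := by
    refine Summable.of_nonneg_of_le (fun _ => norm_nonneg _) (fun j => ?_) h_sum
    rw [← hubbardTorusTruncatedCoeff_of_neZero]
    exact hL j
  rw [hubbardThermalTwoPoint_eq_tsum_truncated β U μ x y σ σ' hs]
  refine tsum_congr fun j => ?_
  rw [hubbardTorusTruncatedCoeff_of_neZero]

/-- **Reduction of the fact `bgm_two_point_limit` to volume-uniform linked-cluster estimates.**
If in BGM's regime (`-4 < μ < -2-√2`, `0 < |U| ≤ U₀`, `0 < β ≤ e^{c/|U|}`) the truncated coefficients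
of the torus two-point function admit, for every pair of sites and spins, a geometric bound
`‖t_j(L)‖ ≤ C/rʲ` with `|U| < r` for all large `L` together with termwise limits `t_j(L) → τ_j`, then
the finite-volume two-point functions converge — i.e. the fact holds. (A proved reduction with the
analytic input as an explicit hypothesis; the input is BGM's Theorem 2.1/§3 with the finite-`L`
bookkeeping of [BM2001], and is NOT asserted here.) [cite: BenfattoGiulianiMastropietro2006, Thm. 1.1, Thm. 2.1] -/
theorem bgm_two_point_limit_of_truncated_bounds
    (h : ∀ μ : ℝ, -4 < μ → μ < -2 - Real.sqrt 2 → ∃ U₀ c : ℝ, 0 < U₀ ∧ 0 < c ∧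
      ∀ U β : ℝ, U ≠ 0 → |U| ≤ U₀ → 0 < β → β ≤ Real.exp (c / |U|) →
        ∀ (x y : Site 2) (σ σ' : Fin 2), ∃ (r C : ℝ) (τ : ℕ → ℂ), |U| < r ∧
          (∀ᶠ L : ℕ in atTop, ∀ j : ℕ, ‖hubbardTorusTruncatedCoeff β μ L x y σ σ' j‖ ≤ C / r ^ j) ∧
          ∀ j : ℕ, Tendsto (fun L : ℕ => hubbardTorusTruncatedCoeff β μ L x y σ σ' j) atTop (𝓝 (τ j))) :
    bgm_two_point_limit := by
  intro μ hμ1 hμ2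
  obtain ⟨U₀, c, hU₀, hc, hreg⟩ := h μ hμ1 hμ2
  refine ⟨U₀, c, hU₀, hc, fun U β hU0 hUU₀ hβ hβc x y σ σ' => ?_⟩
  obtain ⟨r, C, τ, hUr, hC, hlim⟩ := hreg U β hU0 hUU₀ hβ hβc x y σ σ'
  exact ⟨_, tendsto_hubbardThermalTwoPoint_of_truncated_bounds β U μ x y σ σ' hUr hC hlim⟩

end Limit

end Literature.MathematicalPhysics.QuantumLattice
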